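import Literature.Probability.LatticeModels.ProdBernoulliCoupling
import Literature.Probability.Percolation.PercolationProofs
import HarnessLib

/-!
# Stub `stub_pushforward` of crux `ModelFacts` (stmt-CriticalPhenomena-16064), line `pushforward`

Crux: `Summit.CriticalPhenomena.PercolationContinuityZ3.Theses.PercExchangeRateTransport.ModelFacts`
(bookkeeping for the label-coupled anisotropic bond-percolation family on `ℤ²×ℤ`), registered
skeleton `Cruxes/ModelFacts/Lines/pushforward.lean` (sha b7532b73). This file proves the KEYSTONE
registered stub VERBATIM — the two-parameter label push-forward:

`stub_pushforward : ∀ (E : Set (Sym2 (Site 3))) (τ : Sym2 (Site 3) → ℝ),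
  (labelMeasure (Site 3)).map (fun U => {e | e ∈ E ∧ U e ≤ τ e}) =
    prodBernoulli (E.indicator fun e => Set.projIcc 0 1 zero_le_one (τ e))`

— thresholding i.i.d. uniform labels at a real field `τ` on `E` has law `prodBernoulli` with
parameters `projIcc 0 1 (τ e)` on `E` and `0` off `E` (after it, every `Θ_n(p,t)`, `θ(p,t)` of the
crux is a probability under the tree's inhomogeneous product measure `prodBernoulli (param p t)`).

Argument (idea card `ae-relabel-keystone`, crux-ideate r1 k1; Grimmett 1999 §1.3, coupling of all
`P_p` through uniform labels): a.e. every label lies in the OPEN interval `(0,1)`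
(`Measure.infinitePi_map_eval`, `{0,1}` is Lebesgue-null), and there thresholding at `τ e` on `E`
agrees with thresholding at the clamped, zero-extended field `E.indicator (projIcc ∘ τ)`
(`threshold_ae_eq`); then `Measure.map_congr` and the tree's all-coordinates identity
`prodBernoulli_eq_map_labels` finish.

Tree lemmas used: `prodBernoulli_eq_map_labels` (ProdBernoulliCoupling), `labelMeasure`
(= `infinitePi` of `Leb|[0,1]`, by `rfl`), Mathlib `Measure.infinitePi_map_eval`, `Measure.map_congr`.
-/

noncomputable section

open MeasureTheory
open Literature.Probability.Percolation Literature.Probability.LatticeModels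

namespace Summit.CriticalPhenomena.PercolationContinuityZ3.Theorems.ModelFacts

namespace Pushforward

/-- First lemma: thresholding at a real field `τ` on `E` agrees a.e. with thresholding at the
clamped, zero-extended `unitInterval` field (labels lie in `(0,1)` a.s.). -/
theorem threshold_ae_eq (E : Set (Sym2 (Site 3))) (τ : Sym2 (Site 3) → ℝ) :
    (fun U : Sym2 (Site 3) → ℝ => {e | e ∈ E ∧ U e ≤ τ e}) =ᵐ[labelMeasure (Site 3)]
      (fun U => {e | U e ≤ ((E.indicator fun e => Set.projIcc (0 : ℝ) 1 zero_le_one (τ e)) e : ℝ)}) := by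
  have hP : IsProbabilityMeasure ((volume : Measure ℝ).restrict (Set.Icc (0 : ℝ) 1)) :=
    ⟨by simp [Real.volume_Icc]⟩
  -- a.e. every label lies in the OPEN interval `(0, 1)`
  have h1 : ∀ e : Sym2 (Site 3), ∀ᵐ U ∂(labelMeasure (Site 3)), U e ∈ Set.Ioo (0 : ℝ) 1 := by
    intro e
    have hmap := Measure.infinitePi_map_eval
      (fun _ : Sym2 (Site 3) => (volume : Measure ℝ).restrict (Set.Icc (0 : ℝ) 1)) e
    have h' : ∀ᵐ s ∂((labelMeasure (Site 3)).map (fun U => U e)), s ∈ Set.Ioo (0 : ℝ) 1 := by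
      rw [show labelMeasure (Site 3) = Measure.infinitePi
        (fun _ : Sym2 (Site 3) => (volume : Measure ℝ).restrict (Set.Icc (0 : ℝ) 1)) from rfl, hmap,
        ae_restrict_iff' measurableSet_Icc]
      have h0 : (volume : Measure ℝ) {0, 1} = 0 := (Set.toFinite _).measure_zero _
      filter_upwards [measure_eq_zero_iff_ae_notMem.1 h0] with s hs hsI
      simp only [Set.mem_insert_iff, Set.mem_singleton_iff, not_or] at hs
      exact ⟨lt_of_le_of_ne hsI.1 (Ne.symm hs.1), lt_of_le_of_ne hsI.2 hs.2⟩
    exact (ae_map_iff (measurable_pi_apply e).aemeasurable measurableSet_Ioo).1 h'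
  have h2 : ∀ᵐ U ∂(labelMeasure (Site 3)), ∀ e, U e ∈ Set.Ioo (0 : ℝ) 1 := ae_all_iff.2 h1
  filter_upwards [h2] with U hU
  ext e
  simp only [Set.mem_setOf_eq]
  by_cases he : e ∈ E
  · simp only [he, true_and, Set.indicator_of_mem, Set.coe_projIcc]
    constructor
    · intro h
      exact le_max_of_le_right (le_min (hU e).2.le h)
    · intro h
      rcases le_max_iff.1 h with h0 | h1
      · exact absurd h0 (not_le.2 (hU e).1)
      · exact h1.trans (min_le_right _ _)
  · simp only [he, false_and, Set.indicator_of_notMem, not_false_eq_true, false_iff]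
    push_cast
    exact not_le.2 (hU e).1

end Pushforward

open Pushforward in
/-- **Registered stub `stub_pushforward` of line `pushforward` (crux `ModelFacts`,
stmt-CriticalPhenomena-16064), verbatim — the two-parameter label push-forward.** For every set
of pairs `E` and every real threshold field `τ`, thresholding i.i.d. uniform labels at `τ` on `E`
has law `prodBernoulli` with parameters `projIcc 0 1 (τ e)` on `E` and `0` off `E`. Proof:
`Measure.map_congr (threshold_ae_eq E τ)` + the tree's `prodBernoulli_eq_map_labels`.
[folklore] -/
theorem stub_pushforward :
    ∀ (E : Set (Sym2 (Site 3))) (τ : Sym2 (Site 3) → ℝ),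
    (labelMeasure (Site 3)).map (fun U : Sym2 (Site 3) → ℝ => {e | e ∈ E ∧ U e ≤ τ e}) =
      prodBernoulli (E.indicator fun e => Set.projIcc (0 : ℝ) 1 zero_le_one (τ e)) := by
  intro E τ
  rw [Measure.map_congr (threshold_ae_eq E τ), prodBernoulli_eq_map_labels]
  rfl


end Summit.CriticalPhenomena.PercolationContinuityZ3.Theorems.ModelFacts

end
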